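import Literature.AlgebraicGeometry.HodgeTheory.SymmetricA3SliceReduction
import Literature.AlgebraicGeometry.Motives.GeneralNonsingularForms
import HarnessLib

/-!
# Singular points of a small two-parameter perturbation stay near the singular point of the central member
# (programme B2-BIF, far-away exclusion S6/X1, for the binder hB2 `picardLefschetz_symmetricA3` of crux K1-B)

Family `hodge`, layer `Literature/AlgebraicGeometry/HodgeTheory`, next to `PicardLefschetzSymmetricA3` (hypotheses
`IsSymmetricA3Datum`, target `IsSymmetricA3Bifurcation` of the named fact hB2 = `picardLefschetz_symmetricA3` of crux K1-B
of `Summits/HodgeConjecture/HodgeConjecture/Theses/SignSymmetricPowers.lean`, stmt-HodgeConjecture-19716),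
`SymmetricA3SliceReduction` (S0–S1) and `NodalFormPencilNonsingular` (§4 there: the same sphere-projection argument for a
pencil).  Written by the prover seat `hodge-nonav-19716-p2` (g8, cell `hodge-nonav`).

The bifurcation statement `IsSymmetricA3Bifurcation` is GLOBAL on `ℙⁿ⁺¹` ("`f₁ + α g₂ + β g₀` is nonsingular iff …",
"exactly one ∕ two nodes"), while the analysis of AGZV II §5.2 is LOCAL at the `A₃` point `e_j`.  The bridge is
compactness of the unit sphere: since `e_j` is the ONLY singular point of `f₁` (a clause of `IsSymmetricA3Datum`), for
`(α, β)` close to `0` every singular point `[z]` of `f₁ + α g₂ + β g₀` lies in any prescribed neighbourhood of `[e_j]` —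
read in the affine chart `x_j = 1` in which the slice chart of S1 and its uniqueness statement live:

* `eventually_forall_singular_mem` — for forms `f₁, g₀, g₂` of degree `d`, a point `q` with `q_j ≠ 0` such that every
  singular vector of `f₁` is a multiple of `q`, and an open `V ∋ q_j⁻¹ • q`: for `(α, β)` near `0`, every `z ≠ 0` with
  `∇(f₁ + α g₂ + β g₀)(z) = 0` has `z_j ≠ 0`, `z_j⁻¹ • z ∈ V`, and `z_j⁻¹ • z` is again a singular vector
  (projection along the compact unit sphere, `UniversalHypersurface.isClosed_setOf_exists_ne_zero`);
* `IsSymmetricA3Datum.eventually_forall_singular_mem` — the instance `q = e_j` for a symmetric `A₃` datum.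

## References
* [VoisinHodgeII2003] C. Voisin, *Hodge Theory and Complex Algebraic Geometry II*, CUP 2003, §2.3.1–2.3.2 (Lefschetz
  degenerations: the singular points of the nearby members are the prescribed ones).
* [ArnoldGuseinzadeVarchenko2012] AGZV II, Part I §5.2 (the bifurcation set of `B₂` is a LOCAL statement at the
  singular point; pp. 132–133).
-/

noncomputable section

open MvPolynomial Set Filter
open scoped Topology
open Literature.AlgebraicGeometry.Motives Literature.AlgebraicGeometry.Motives.UniversalHypersurface

namespace Literature.AlgebraicGeometry.HodgeTheory

section HodgeTheory

variable {n d : ℕ}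

/-- The member `f₁ + α g₂ + β g₀` is homogeneous of degree `d`. [cite: ArnoldGuseinzadeVarchenko2012, Part I §5.2] -/
private theorem isHomogeneous_member {f₁ g₀ g₂ : MvPolynomial (Fin (n + 2)) ℂ} (hf₁ : f₁.IsHomogeneous d)
    (hg₀ : g₀.IsHomogeneous d) (hg₂ : g₂.IsHomogeneous d) (μ : ℂ × ℂ) :
    (f₁ + μ.1 • g₂ + μ.2 • g₀).IsHomogeneous d := by
  rw [MvPolynomial.smul_eq_C_mul, MvPolynomial.smul_eq_C_mul]
  exact (hf₁.add (hg₂.C_mul _)).add (hg₀.C_mul _)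

/-- The partials of the member, expanded. [cite: ArnoldGuseinzadeVarchenko2012, Part I §5.2] -/
private theorem eval_pderiv_member (f₁ g₀ g₂ : MvPolynomial (Fin (n + 2)) ℂ) (μ : ℂ × ℂ) (z : Fin (n + 2) → ℂ)
    (i : Fin (n + 2)) :
    eval z (pderiv i (f₁ + μ.1 • g₂ + μ.2 • g₀)) =
      eval z (pderiv i f₁) + μ.1 * eval z (pderiv i g₂) + μ.2 * eval z (pderiv i g₀) := by
  simp [smul_eval, map_add, (pderiv i).map_smul]

/-- **Singular points of a small two-parameter perturbation stay near the singular point of the central member.**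
Let `f₁, g₀, g₂` be forms of degree `d` on `ℙⁿ⁺¹_ℂ`, `q` a vector with `q_j ≠ 0` such that every `z ≠ 0` at which all
partials of `f₁` vanish is a multiple of `q` (`[q]` is the only singular point of `V(f₁)`), and `V` an open
neighbourhood of the chart representative `q_j⁻¹ • q`.  Then for `(α, β)` close to `0`: every `z ≠ 0` at which all
partials of `f₁ + α g₂ + β g₀` vanish has `z_j ≠ 0`, its chart representative `z_j⁻¹ • z` lies in `V`, and all partials
vanish at `z_j⁻¹ • z` as well.  (The parameters carrying a singular vector OUTSIDE the homothety-stable open set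
`{z | z_j ≠ 0, z_j⁻¹ • z ∈ V}` form a closed set — projection along the compact unit sphere — not containing `0`.)
[cite: VoisinHodgeII2003, §2.3.1–2.3.2] [cite: ArnoldGuseinzadeVarchenko2012, Part I §5.2] -/
theorem eventually_forall_singular_mem {f₁ g₀ g₂ : MvPolynomial (Fin (n + 2)) ℂ} (hf₁ : f₁.IsHomogeneous d)
    (hg₀ : g₀.IsHomogeneous d) (hg₂ : g₂.IsHomogeneous d) {q : Fin (n + 2) → ℂ} {j : Fin (n + 2)} (hqj : q j ≠ 0)
    (huniq : ∀ z : Fin (n + 2) → ℂ, z ≠ 0 → (∀ i, eval z (pderiv i f₁) = 0) → ∃ t : ℂ, z = t • q)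
    {V : Set (Fin (n + 2) → ℂ)} (hV : IsOpen V) (hqV : (q j)⁻¹ • q ∈ V) :
    ∀ᶠ μ in 𝓝 (0 : ℂ × ℂ), ∀ z : Fin (n + 2) → ℂ, z ≠ 0 →
      (∀ i, eval z (pderiv i (f₁ + μ.1 • g₂ + μ.2 • g₀)) = 0) →
        z j ≠ 0 ∧ (z j)⁻¹ • z ∈ V ∧ ∀ i, eval ((z j)⁻¹ • z) (pderiv i (f₁ + μ.1 • g₂ + μ.2 • g₀)) = 0 := by
  classical
  -- the homothety-stable open set of good vectors
  let Good : Set (Fin (n + 2) → ℂ) := {z | z j ≠ 0 ∧ (z j)⁻¹ • z ∈ V}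
  have hU : IsOpen {z : Fin (n + 2) → ℂ | z j ≠ 0} := isOpen_ne_fun (continuous_apply j) continuous_const
  have hGood : IsOpen Good := by
    have hc : ContinuousOn (fun z : Fin (n + 2) → ℂ => (z j)⁻¹ • z) {z | z j ≠ 0} :=
      (((continuous_apply j).continuousOn).inv₀ fun z hz => hz).smul continuousOn_id
    have h := hc.isOpen_inter_preimage hU hV
    exact h
  have hGood_smul : ∀ (t : ℂ), t ≠ 0 → ∀ z, z ∈ Good ↔ t • z ∈ Good := by
    intro t ht z
    have hcoord : (t • z) j = t * z j := rfl
    have hrep : ∀ (hz : z j ≠ 0), ((t • z) j)⁻¹ • (t • z) = (z j)⁻¹ • z := by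
      intro hz
      rw [hcoord, smul_smul]
      congr 1
      field_simp
    constructor
    · rintro ⟨hz, hzV⟩
      exact ⟨by rw [hcoord]; exact mul_ne_zero ht hz, by rw [hrep hz]; exact hzV⟩
    · rintro ⟨htz, htzV⟩
      have hz : z j ≠ 0 := fun h => htz (by rw [hcoord, h, mul_zero])
      exact ⟨hz, by rw [← hrep hz]; exact htzV⟩
  -- the bad condition: singular and not good; closed and stable under positive rescaling
  let P : (ℂ × ℂ) → (Fin (n + 2) → ℂ) → Prop := fun μ z =>
    (∀ i, eval z (pderiv i (f₁ + μ.1 • g₂ + μ.2 • g₀)) = 0) ∧ z ∉ Good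
  have hPclosed : IsClosed {p : (ℂ × ℂ) × (Fin (n + 2) → ℂ) | P p.1 p.2} := by
    have h1 : IsClosed {p : (ℂ × ℂ) × (Fin (n + 2) → ℂ) | ∀ i, eval p.2 (pderiv i (f₁ + p.1.1 • g₂ + p.1.2 • g₀)) = 0} := by
      rw [show {p : (ℂ × ℂ) × (Fin (n + 2) → ℂ) | ∀ i, eval p.2 (pderiv i (f₁ + p.1.1 • g₂ + p.1.2 • g₀)) = 0} =
          ⋂ i, {p : (ℂ × ℂ) × (Fin (n + 2) → ℂ) | eval p.2 (pderiv i (f₁ + p.1.1 • g₂ + p.1.2 • g₀)) = 0} by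
        ext p; simp]
      refine isClosed_iInter fun i => ?_
      simp only [eval_pderiv_member]
      refine isClosed_eq ?_ continuous_const
      have he : ∀ G : MvPolynomial (Fin (n + 2)) ℂ, Continuous fun p : (ℂ × ℂ) × (Fin (n + 2) → ℂ) => eval p.2 G :=
        fun G => (MvPolynomial.continuous_eval G).comp continuous_snd
      fun_prop
    have h2 : IsClosed {p : (ℂ × ℂ) × (Fin (n + 2) → ℂ) | p.2 ∉ Good} :=
      (hGood.isClosed_compl).preimage continuous_snd
    exact h1.inter h2
  have hPscale : ∀ μ z (t : ℝ), 0 < t → P μ z → P μ ((t : ℂ) • z) := by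
    intro μ z t ht ⟨hsing, hbad⟩
    have ht0 : (t : ℂ) ≠ 0 := by exact_mod_cast ht.ne'
    refine ⟨fun i => ?_, fun h => hbad ((hGood_smul (t : ℂ) ht0 z).2 h)⟩
    rw [eval_smul_of_isHomogeneous n ((isHomogeneous_member hf₁ hg₀ hg₂ μ).pderiv (i := i)), hsing i, mul_zero]
  have hBclosed := UniversalHypersurface.isClosed_setOf_exists_ne_zero P hPclosed hPscale
  -- `0` is not a bad parameter: the singular vectors of `f₁` are the multiples of `q`, all good
  have h0 : (0 : ℂ × ℂ) ∉ {μ : ℂ × ℂ | ∃ z : Fin (n + 2) → ℂ, z ≠ 0 ∧ P μ z} := by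
    rintro ⟨z, hz, hsing, hbad⟩
    have hsing' : ∀ i, eval z (pderiv i f₁) = 0 := fun i => by
      have h := hsing i
      simpa [eval_pderiv_member] using h
    obtain ⟨t, rfl⟩ := huniq z hz hsing'
    have ht : t ≠ 0 := by rintro rfl; exact hz (zero_smul _ _)
    exact hbad ((hGood_smul t ht q).1 ⟨hqj, hqV⟩)
  have hev : ∀ᶠ μ in 𝓝 (0 : ℂ × ℂ), μ ∉ {μ : ℂ × ℂ | ∃ z : Fin (n + 2) → ℂ, z ≠ 0 ∧ P μ z} :=
    hBclosed.isOpen_compl.mem_nhds h0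
  filter_upwards [hev] with μ hμ z hz hsing
  have hgood : z ∈ Good := by
    by_contra hbad
    exact hμ ⟨z, hz, hsing, hbad⟩
  refine ⟨hgood.1, hgood.2, fun i => ?_⟩
  rw [eval_smul_of_isHomogeneous n ((isHomogeneous_member hf₁ hg₀ hg₂ μ).pderiv (i := i)), hsing i, mul_zero]

/-- **Instance for a symmetric `A₃` datum**: for `(α, β)` near `0`, every singular vector `z ≠ 0` of
`f₁ + α g₂ + β g₀` has `z_j ≠ 0` and its chart representative `z_j⁻¹ • z` (which has `j`-coordinate `1` and is again
singular) lies in any prescribed open `V ∋ e_j` — e.g. a box on which the slice chart of `exists_sliceChart` is unique.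
[cite: ArnoldGuseinzadeVarchenko2012, Part I §5.2] [cite: VoisinHodgeII2003, §2.3.1–2.3.2] -/
theorem IsSymmetricA3Datum.eventually_forall_singular_mem {f₁ g₀ g₂ : MvPolynomial (Fin (n + 2)) ℂ}
    {j k : Fin (n + 2)} {a : Fin (n + 2) → ℂˣ} (hf₁ : f₁.IsHomogeneous d) (hg₀ : g₀.IsHomogeneous d)
    (hg₂ : g₂.IsHomogeneous d) (hD : IsSymmetricA3Datum f₁ g₀ g₂ j k a) {V : Set (Fin (n + 2) → ℂ)} (hV : IsOpen V)
    (hjV : (Pi.single j (1 : ℂ) : Fin (n + 2) → ℂ) ∈ V) :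
    ∀ᶠ μ in 𝓝 (0 : ℂ × ℂ), ∀ z : Fin (n + 2) → ℂ, z ≠ 0 →
      (∀ i, eval z (pderiv i (f₁ + μ.1 • g₂ + μ.2 • g₀)) = 0) →
        z j ≠ 0 ∧ ((z j)⁻¹ • z) j = 1 ∧ (z j)⁻¹ • z ∈ V ∧
          ∀ i, eval ((z j)⁻¹ • z) (pderiv i (f₁ + μ.1 • g₂ + μ.2 • g₀)) = 0 := by
  have hqj : (Pi.single j (1 : ℂ) : Fin (n + 2) → ℂ) j ≠ 0 := by simp
  have hqV : ((Pi.single j (1 : ℂ) : Fin (n + 2) → ℂ) j)⁻¹ • (Pi.single j (1 : ℂ) : Fin (n + 2) → ℂ) ∈ V := by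
    simpa using hjV
  filter_upwards [Literature.AlgebraicGeometry.HodgeTheory.eventually_forall_singular_mem hf₁ hg₀ hg₂ hqj hD.2.2.1
    hV hqV] with μ hμ z hz hsing
  obtain ⟨h1, h2, h3⟩ := hμ z hz hsing
  exact ⟨h1, by simp [h1], h2, h3⟩

end HodgeTheory

end Literature.AlgebraicGeometry.HodgeTheory

end
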